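import Mathlib
import Literature.Analysis.FluidPDE.TorusABCFlow
import Literature.Analysis.FunctionSpaces.TorusTestFunction
import Summits.NavierStokesRegularity.FluidComputer.SkewCutCertificate
import Summits.NavierStokesRegularity.FluidComputer.SharpH2TailDissipativity
import HarnessLib

/-!
# The five Frobenius constants of the ABC flow on the unit torus (cap g5, cell `ns-blowup`, 2026-08-26)

HONEST FRAMING (human ruling D-0035): nothing here is a claim about Navier–Stokes blow-up.
WHAT THIS IS NOT: not NS evidence. Instantiation facts (D2-CHAIN-MAP step S7 (c)) for the TREE
object `Literature.Analysis.FluidPDE.Torus.abcFlow 1 1 1 : UnitAddTorus (Fin 3) → ℝ³` (MB (2.49) on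
the UNIT torus, `Xⱼ = 2πxⱼ`): explicit first and second partial derivatives and the pointwise
structural constants that `SharpH2TailDissipativity.sharp_tail_form_le` consumes —
`F² = Σⱼ‖∂ⱼU‖² = 12π²`, `P² = ΣₘΣⱼ‖∂ⱼ∂ₘU‖² = 48π⁴`, `‖ΔU‖ ≤ 4π²√6`, `Q² = Σⱼ‖∂ⱼΔU‖² = 192π⁶`,
strain `|⟪Σⱼaⱼ∂ⱼU, a⟫| ≤ 2π√2‖a‖²` — i.e. `(s, F, L₂, P, Q) = (2π√2, 2π√3, 4π²√6, 4π²√3, 8π³√3)`,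
the `(2π)ʲ`-rescaled `(√2, √3, √6, √3, √3)` of INSTAB-BRIDGE §11 l.109 — and the CAPSTONE
`abc_tail_form_le`: the tail inequality of THEOREM 3-L for the linearisation of true Navier–Stokes
about `U` written on the unit torus (`A₁ = (ν/4π²)Δ − (1/2π)[(U·∇)· + (·∇)U]`, the image of
`νΔ − [(U·∇)· + (·∇)U]` on `(ℝ/2πℤ)³` under `X = 2πx`), for every smooth tail field `w` with no
Fourier modes in `|k|² ≤ N²`:
`(ν/4π²)∫⟪ΔΔw, Δw⟫ − (1/2π)∫⟪(U·∇)w + (w·∇)U, ΔΔw⟫ − ω‖Δw‖₂²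
   ≤ (−ν(N²+1) − ω + (2√3 + √2) + (√6 + 2√3)(N²+1)^{-1/2} + √3 (N²+1)^{-1}) · ‖Δw‖₂²`
— every `2π` cancels and the coefficient is LITERALLY the paper's `−ν(K+1)² − ω + c₀ + c₁/(K+1) + c₂/(K+1)²`
with `(K+1)² ↔ N² + 1` (so `AbcKappa0TailLevels.eta2_at_25_bounds` etc. apply with `N² + 1 = 625`,
i.e. to tails beyond the ball `|k|² ≤ 624 = 25² − 1`, which contain the cube tail `|k|_∞ ≥ 25` by
`CubeShellAdjacency.sq_le_sum_sq_of_exists_abs_ge`). This closes D2-CHAIN-MAP S7 (a) AND the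
rescaling sentence of S7 (c) in the kernel; what stays prose there is only «ℙ drops on divergence-free
test fields» (true by `⟨Δ²w, ℙf⟩ = ⟨Δ²w, f⟩`, INSTAB-BRIDGE §11 l.107) and the cube-vs-ball tail
bookkeeping just stated.

Mathlib + `TorusABCFlow` + `SkewCutCertificate` (Lemma S) + `SharpH2TailDissipativity`; no new
definitions.
-/

noncomputable section

namespace Summit.NavierStokesRegularity.FluidComputer.AbcFlowFrobeniusConstants

open Literature.Analysis.FluidPDE Literature.Analysis.FunctionSpaces
open Literature.Analysis.FunctionSpaces.Torus UnitAddTorus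
open scoped RealInnerProductSpace ComplexConjugate

/-- Every index of `Fin 3` is `0`, `1` or `2`. -/
private theorem fin3_cases (i : Fin 3) : i = 0 ∨ i = 1 ∨ i = 2 := by
  fin_cases i <;> simp

/-- `+eⱼ` is the `j`-th unit lattice vector. -/
private theorem abcDir_true (j : Fin 3) : Torus.abcDir (j, true) = Pi.single j 1 := by
  simp [Torus.abcDir]

/-- `−eⱼ = −(+eⱼ)`. -/
private theorem abcDir_false (j : Fin 3) : Torus.abcDir (j, false) = -Pi.single j 1 := by
  rw [← abcDir_true, Torus.neg_abcDir]; rfl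

/-- Characters have modulus one: `‖e_n(x)‖ = 1`. -/
theorem norm_mFourier_apply {d : Type*} [Fintype d] (n : d → ℤ) (x : UnitAddTorus d) :
    ‖mFourier n x‖ = 1 := by
  simp only [mFourier, fourier_apply, ContinuousMap.coe_mk, norm_prod, Circle.norm_coe,
    Finset.prod_const_one]

/-- `cos² Xⱼ + sin² Xⱼ = 1` for the character `eⱼ(x) = cos Xⱼ + i sin Xⱼ`. -/
theorem re_sq_add_im_sq_mFourier {d : Type*} [Fintype d] (n : d → ℤ) (x : UnitAddTorus d) :
    (mFourier n x).re ^ 2 + (mFourier n x).im ^ 2 = 1 := by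
  have h := norm_mFourier_apply n x
  have h2 : ‖mFourier n x‖ ^ 2 = 1 := by rw [h]; norm_num
  rw [Complex.sq_norm, Complex.normSq_apply] at h2
  nlinarith [h2]

/-- **First derivatives of the ABC flow on the unit torus, componentwise.** With `a = (B, C, A)`
(`Torus.abcAmp`) and `eⱼ(x) = cos Xⱼ + i sin Xⱼ`:
`(∂ⱼU)ᵢ = 2π·( a_{i+2}·[j = i+2]·cos Xⱼ − a_{i+1}·[j = i+1]·sin Xⱼ )`
(since `Uᵢ = a_{i+2} sin X_{i+2} + a_{i+1} cos X_{i+1}`). -/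
theorem partialDeriv_abcFlow_apply (A B C : ℝ) (x : UnitAddTorus (Fin 3)) (j i : Fin 3) :
    partialDeriv j (Torus.abcFlow A B C) x i =
      2 * Real.pi * ((if j = i + 2 then Torus.abcAmp A B C (i + 2) * (mFourier (Pi.single (j : Fin 3) (1:ℤ)) x).re else 0)
        - (if j = i + 1 then Torus.abcAmp A B C (i + 1) * (mFourier (Pi.single (j : Fin 3) (1:ℤ)) x).im else 0)) := by
  rw [Torus.abcFlow_eq_realTrigPoly, partialDeriv_realTrigPoly, realTrigPoly_apply_coord,
    trigPoly_apply_coord, Torus.sum_abcFreq, Fintype.sum_prod_type]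
  simp only [Fin.sum_univ_three, Fintype.sum_bool]
  have hneg : ∀ m : Fin 3, mFourier (Torus.abcDir (m, false)) x = conj (mFourier (Pi.single m (1:ℤ)) x) :=
    fun m => by rw [abcDir_false, mFourier_neg]
  simp only [hneg, abcDir_true]
  have hd : ∀ (m : Fin 3) (b : Bool) (l : Fin 3),
      ((Torus.abcDir (m, b) l : ℤ) : ℂ) = if l = m then (if b then 1 else -1) else 0 := by
    intro m b l; rw [Torus.abcDir_apply]; split_ifs <;> simp
  simp only [PiLp.smul_apply, smul_eq_mul, Torus.abcCoeff_apply, hd]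
  have h01 : (0 : Fin 3) + 1 = 1 := by decide
  have h02 : (0 : Fin 3) + 2 = 2 := by decide
  have h11 : (1 : Fin 3) + 1 = 2 := by decide
  have h12 : (1 : Fin 3) + 2 = 0 := by decide
  have h21 : (2 : Fin 3) + 1 = 0 := by decide
  have h22 : (2 : Fin 3) + 2 = 1 := by decide
  rcases fin3_cases i with rfl | rfl | rfl <;> rcases fin3_cases j with rfl | rfl | rfl <;>
    simp [h01, h02, h11, h12, h21, h22, Torus.abcAmp, Complex.mul_re, Complex.mul_im,
      Complex.conj_re, Complex.conj_im] <;> ring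

/-- `ofLp` form of `partialDeriv_abcFlow_apply` (the shape produced by `PiLp.inner_apply`). -/
theorem partialDeriv_abcFlow_ofLp (A B C : ℝ) (x : UnitAddTorus (Fin 3)) (j i : Fin 3) :
    (partialDeriv j (Torus.abcFlow A B C) x).ofLp i =
      2 * Real.pi * ((if j = i + 2 then Torus.abcAmp A B C (i + 2) * (mFourier (Pi.single (j : Fin 3) (1:ℤ)) x).re else 0)
        - (if j = i + 1 then Torus.abcAmp A B C (i + 1) * (mFourier (Pi.single (j : Fin 3) (1:ℤ)) x).im else 0)) :=
  partialDeriv_abcFlow_apply A B C x j i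

/-- Addition table of `Fin 3`. -/
private theorem fin3_add :
    (0 : Fin 3) + 1 = 1 ∧ (0 : Fin 3) + 2 = 2 ∧ (1 : Fin 3) + 1 = 2 ∧ (1 : Fin 3) + 2 = 0 ∧
      (2 : Fin 3) + 1 = 0 ∧ (2 : Fin 3) + 2 = 1 := by
  decide

/-- **Second derivatives of the ABC flow on the unit torus, componentwise.** Mixed partials vanish
and `(∂ⱼ²U)ᵢ = −4π²·( a_{i+2}·[j = i+2]·sin Xⱼ + a_{i+1}·[j = i+1]·cos Xⱼ )`. -/
theorem partialDeriv_partialDeriv_abcFlow_apply (A B C : ℝ) (x : UnitAddTorus (Fin 3))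
    (m j i : Fin 3) :
    partialDeriv m (partialDeriv j (Torus.abcFlow A B C)) x i =
      if m = j then
        -(4 * Real.pi ^ 2) * ((if j = i + 2 then Torus.abcAmp A B C (i + 2) * (mFourier (Pi.single (j : Fin 3) (1:ℤ)) x).im else 0)
          + (if j = i + 1 then Torus.abcAmp A B C (i + 1) * (mFourier (Pi.single (j : Fin 3) (1:ℤ)) x).re else 0))
      else 0 := by
  rw [Torus.abcFlow_eq_realTrigPoly, partialDeriv_realTrigPoly', partialDeriv_realTrigPoly,
    realTrigPoly_apply_coord, trigPoly_apply_coord, Torus.sum_abcFreq, Fintype.sum_prod_type]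
  simp only [Fin.sum_univ_three, Fintype.sum_bool]
  have hneg : ∀ m : Fin 3, mFourier (Torus.abcDir (m, false)) x = conj (mFourier (Pi.single m (1:ℤ)) x) :=
    fun m => by rw [abcDir_false, mFourier_neg]
  simp only [hneg, abcDir_true]
  have hd : ∀ (m : Fin 3) (b : Bool) (l : Fin 3),
      ((Torus.abcDir (m, b) l : ℤ) : ℂ) = if l = m then (if b then 1 else -1) else 0 := by
    intro m b l; rw [Torus.abcDir_apply]; split_ifs <;> simp
  simp only [PiLp.smul_apply, smul_eq_mul, Torus.abcCoeff_apply, hd]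
  obtain ⟨h01, h02, h11, h12, h21, h22⟩ := fin3_add
  rcases fin3_cases i with rfl | rfl | rfl <;> rcases fin3_cases j with rfl | rfl | rfl <;>
    rcases fin3_cases m with rfl | rfl | rfl <;>
    simp [h01, h02, h11, h12, h21, h22, Torus.abcAmp, Complex.mul_re, Complex.mul_im,
      Complex.conj_re, Complex.conj_im] <;> ring

/-- **`F² = Σⱼ‖∂ⱼU‖² = 4π²(A² + B² + C²)` pointwise** (`= 12π²` for `abc(1,1,1)`: `F = 2π√3`, the
unit-torus form of `|∇U|_F² = 3`). -/
theorem sum_norm_sq_partialDeriv_abcFlow (A B C : ℝ) (x : UnitAddTorus (Fin 3)) :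
    ∑ j, ‖partialDeriv j (Torus.abcFlow A B C) x‖ ^ 2 = 4 * Real.pi ^ 2 * (A ^ 2 + B ^ 2 + C ^ 2) := by
  have e0 := re_sq_add_im_sq_mFourier (Pi.single (0 : Fin 3) (1:ℤ)) x
  have e1 := re_sq_add_im_sq_mFourier (Pi.single (1 : Fin 3) (1:ℤ)) x
  have e2 := re_sq_add_im_sq_mFourier (Pi.single (2 : Fin 3) (1:ℤ)) x
  obtain ⟨h01, h02, h11, h12, h21, h22⟩ := fin3_add
  simp only [EuclideanSpace.real_norm_sq_eq, Fin.sum_univ_three, partialDeriv_abcFlow_apply,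
    h01, h02, h11, h12, h21, h22, Torus.abcAmp]
  simp
  linear_combination (4 * Real.pi ^ 2 * B ^ 2) * e0 + (4 * Real.pi ^ 2 * C ^ 2) * e1
    + (4 * Real.pi ^ 2 * A ^ 2) * e2

/-- **`P² = ΣₘΣⱼ‖∂ⱼ∂ₘU‖² = 16π⁴(A² + B² + C²)` pointwise** (`= 48π⁴` for `abc(1,1,1)`:
`P = 4π²√3`; only the pure second derivatives survive and each has length `4π²|aⱼ|`). -/
theorem sum_sum_norm_sq_partialDeriv_partialDeriv_abcFlow (A B C : ℝ) (x : UnitAddTorus (Fin 3)) :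
    ∑ m, ∑ j, ‖partialDeriv j (partialDeriv m (Torus.abcFlow A B C)) x‖ ^ 2
      = 16 * Real.pi ^ 4 * (A ^ 2 + B ^ 2 + C ^ 2) := by
  have e0 := re_sq_add_im_sq_mFourier (Pi.single (0 : Fin 3) (1:ℤ)) x
  have e1 := re_sq_add_im_sq_mFourier (Pi.single (1 : Fin 3) (1:ℤ)) x
  have e2 := re_sq_add_im_sq_mFourier (Pi.single (2 : Fin 3) (1:ℤ)) x
  obtain ⟨h01, h02, h11, h12, h21, h22⟩ := fin3_add
  simp only [EuclideanSpace.real_norm_sq_eq, Fin.sum_univ_three,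
    partialDeriv_partialDeriv_abcFlow_apply, h01, h02, h11, h12, h21, h22, Torus.abcAmp]
  simp
  linear_combination (16 * Real.pi ^ 4 * B ^ 2) * e0 + (16 * Real.pi ^ 4 * C ^ 2) * e1
    + (16 * Real.pi ^ 4 * A ^ 2) * e2

/-- **`‖U(x)‖² ≤ 2(A² + B² + C²)` pointwise** (`≤ 6` for `abc(1,1,1)`, attained at
`X = (π/4, π/4, π/4)`): `(a sin α + b cos β)² ≤ 2a² sin²α + 2b² cos²β` and regrouping by angle. -/
theorem norm_sq_abcFlow_le (A B C : ℝ) (x : UnitAddTorus (Fin 3)) :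
    ‖Torus.abcFlow A B C x‖ ^ 2 ≤ 2 * (A ^ 2 + B ^ 2 + C ^ 2) := by
  have e0 := re_sq_add_im_sq_mFourier (Pi.single (0 : Fin 3) (1:ℤ)) x
  have e1 := re_sq_add_im_sq_mFourier (Pi.single (1 : Fin 3) (1:ℤ)) x
  have e2 := re_sq_add_im_sq_mFourier (Pi.single (2 : Fin 3) (1:ℤ)) x
  obtain ⟨h01, h02, h11, h12, h21, h22⟩ := fin3_add
  rw [EuclideanSpace.real_norm_sq_eq, Fin.sum_univ_three]
  simp only [Torus.abcFlow_apply, h01, h02, h11, h12, h21, h22, Torus.abcAmp]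
  simp
  nlinarith [sq_nonneg (A * (mFourier (Pi.single (2 : Fin 3) (1:ℤ)) x).im - C * (mFourier (Pi.single (1 : Fin 3) (1:ℤ)) x).re),
    sq_nonneg (B * (mFourier (Pi.single (0 : Fin 3) (1:ℤ)) x).im - A * (mFourier (Pi.single (2 : Fin 3) (1:ℤ)) x).re),
    sq_nonneg (C * (mFourier (Pi.single (1 : Fin 3) (1:ℤ)) x).im - B * (mFourier (Pi.single (0 : Fin 3) (1:ℤ)) x).re), e0, e1, e2,
    mul_nonneg (sq_nonneg A) (sq_nonneg (mFourier (Pi.single (2 : Fin 3) (1:ℤ)) x).re), mul_nonneg (sq_nonneg A) (sq_nonneg (mFourier (Pi.single (2 : Fin 3) (1:ℤ)) x).im),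
    mul_nonneg (sq_nonneg B) (sq_nonneg (mFourier (Pi.single (0 : Fin 3) (1:ℤ)) x).re), mul_nonneg (sq_nonneg B) (sq_nonneg (mFourier (Pi.single (0 : Fin 3) (1:ℤ)) x).im),
    mul_nonneg (sq_nonneg C) (sq_nonneg (mFourier (Pi.single (1 : Fin 3) (1:ℤ)) x).re), mul_nonneg (sq_nonneg C) (sq_nonneg (mFourier (Pi.single (1 : Fin 3) (1:ℤ)) x).im)]

/-- **`‖ΔU(x)‖ ≤ 4π²·√(2(A² + B² + C²))`** (`= 4π²√6` for `abc(1,1,1)`: `L₂`), from `ΔU = −4π²U`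
(`Torus.laplacian_abcFlow`) and the pointwise bound on `‖U‖`. -/
theorem norm_laplacian_abcFlow_le (A B C : ℝ) (x : UnitAddTorus (Fin 3)) :
    ‖laplacian (Torus.abcFlow A B C) x‖ ≤ 4 * Real.pi ^ 2 * Real.sqrt (2 * (A ^ 2 + B ^ 2 + C ^ 2)) := by
  rw [Torus.laplacian_abcFlow, norm_neg, norm_smul, Real.norm_eq_abs,
    abs_of_nonneg (by positivity : (0:ℝ) ≤ 4 * Real.pi ^ 2)]
  refine mul_le_mul_of_nonneg_left ?_ (by positivity)
  exact Real.le_sqrt_of_sq_le (norm_sq_abcFlow_le A B C x)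

/-- **`Q² = Σⱼ‖∂ⱼΔU‖² = 64π⁶(A² + B² + C²)` pointwise** (`= 192π⁶` for `abc(1,1,1)`: `Q = 8π³√3`),
since `∂ⱼΔU = −4π²∂ⱼU`. -/
theorem sum_norm_sq_partialDeriv_laplacian_abcFlow (A B C : ℝ) (x : UnitAddTorus (Fin 3)) :
    ∑ j, ‖partialDeriv j (laplacian (Torus.abcFlow A B C)) x‖ ^ 2
      = 64 * Real.pi ^ 6 * (A ^ 2 + B ^ 2 + C ^ 2) := by
  have hΔ : laplacian (Torus.abcFlow A B C) = (-(4 * Real.pi ^ 2)) • Torus.abcFlow A B C := by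
    funext y; rw [Torus.laplacian_abcFlow, Pi.smul_apply, neg_smul]
  have hd : ∀ j, partialDeriv j (laplacian (Torus.abcFlow A B C)) x
      = (-(4 * Real.pi ^ 2)) • partialDeriv j (Torus.abcFlow A B C) x := by
    intro j
    rw [hΔ, partialDeriv_const_smul ((Torus.isSmooth_abcFlow A B C).isContDiff (by simp))]
    rfl
  simp_rw [hd, norm_smul, mul_pow, ← Finset.mul_sum, sum_norm_sq_partialDeriv_abcFlow]
  rw [Real.norm_eq_abs, abs_neg, abs_of_nonneg (by positivity : (0:ℝ) ≤ 4 * Real.pi ^ 2)]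
  ring

/-- **Strain bound (Lemma S on the unit torus): `|⟪(a·∇)U(x), a⟫| ≤ 2π√2‖a‖²`** for
`U = abc(1,1,1)` — the form `Σᵢⱼ aᵢaⱼ(∂ⱼU)ᵢ` is `2π` times the symmetric form of
`SkewCutCertificate.abc_strain_form_abs_le` at the angles `(X₀, X₁, X₂)`. -/
theorem abs_inner_strain_abcFlow_le (x : UnitAddTorus (Fin 3)) (a : EuclideanSpace ℝ (Fin 3)) :
    |⟪∑ j, a j • partialDeriv j (Torus.abcFlow 1 1 1) x, a⟫|
      ≤ 2 * Real.pi * Real.sqrt 2 * ‖a‖ ^ 2 := by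
  obtain ⟨h01, h02, h11, h12, h21, h22⟩ := fin3_add
  -- angles θⱼ with cos θⱼ = Re eⱼ(x), sin θⱼ = Im eⱼ(x)
  have hcs : ∀ j : Fin 3, Real.cos (Complex.arg (mFourier (Pi.single (j : Fin 3) (1:ℤ)) x)) = (mFourier (Pi.single (j : Fin 3) (1:ℤ)) x).re
      ∧ Real.sin (Complex.arg (mFourier (Pi.single (j : Fin 3) (1:ℤ)) x)) = (mFourier (Pi.single (j : Fin 3) (1:ℤ)) x).im := by
    intro j
    have hn := norm_mFourier_apply (Pi.single j (1:ℤ)) x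
    have h1 := Complex.norm_mul_cos_arg (mFourier (Pi.single (j : Fin 3) (1:ℤ)) x)
    have h2 := Complex.norm_mul_sin_arg (mFourier (Pi.single (j : Fin 3) (1:ℤ)) x)
    rw [hn, one_mul] at h1 h2
    exact ⟨h1, h2⟩
  obtain ⟨hc0, hs0⟩ := hcs 0
  obtain ⟨hc1, hs1⟩ := hcs 1
  obtain ⟨hc2, hs2⟩ := hcs 2
  have hform : ⟪∑ j, a j • partialDeriv j (Torus.abcFlow 1 1 1) x, a⟫
      = 2 * Real.pi * (2 * ((Real.cos (Complex.arg (mFourier (Pi.single (0 : Fin 3) (1:ℤ)) x)) - Real.sin (Complex.arg (mFourier (Pi.single (1 : Fin 3) (1:ℤ)) x))) / 2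
          * a 0 * a 1
        + (Real.cos (Complex.arg (mFourier (Pi.single (2 : Fin 3) (1:ℤ)) x)) - Real.sin (Complex.arg (mFourier (Pi.single (0 : Fin 3) (1:ℤ)) x))) / 2 * a 0 * a 2
        + (Real.cos (Complex.arg (mFourier (Pi.single (1 : Fin 3) (1:ℤ)) x)) - Real.sin (Complex.arg (mFourier (Pi.single (2 : Fin 3) (1:ℤ)) x))) / 2 * a 1 * a 2)) := by
    rw [hc0, hs0, hc1, hs1, hc2, hs2]
    simp only [PiLp.inner_apply, RCLike.inner_apply, conj_trivial, Fin.sum_univ_three]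
    simp [partialDeriv_abcFlow_ofLp, h01, h02, h11, h12, h21, h22, Torus.abcAmp]
    ring
  have hS := SkewCutCertificate.abc_strain_form_abs_le (Complex.arg (mFourier (Pi.single (0 : Fin 3) (1:ℤ)) x))
    (Complex.arg (mFourier (Pi.single (1 : Fin 3) (1:ℤ)) x)) (Complex.arg (mFourier (Pi.single (2 : Fin 3) (1:ℤ)) x)) (a 0) (a 1) (a 2)
  have hnorm : ‖a‖ ^ 2 = a 0 ^ 2 + a 1 ^ 2 + a 2 ^ 2 := by
    rw [EuclideanSpace.real_norm_sq_eq, Fin.sum_univ_three]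
  rw [hform, abs_mul, abs_of_nonneg (by positivity : (0:ℝ) ≤ 2 * Real.pi), hnorm]
  calc 2 * Real.pi * |2 * ((Real.cos (Complex.arg (mFourier (Pi.single (0 : Fin 3) (1:ℤ)) x)) - Real.sin (Complex.arg (mFourier (Pi.single (1 : Fin 3) (1:ℤ)) x))) / 2
          * a 0 * a 1
        + (Real.cos (Complex.arg (mFourier (Pi.single (2 : Fin 3) (1:ℤ)) x)) - Real.sin (Complex.arg (mFourier (Pi.single (0 : Fin 3) (1:ℤ)) x))) / 2 * a 0 * a 2
        + (Real.cos (Complex.arg (mFourier (Pi.single (1 : Fin 3) (1:ℤ)) x)) - Real.sin (Complex.arg (mFourier (Pi.single (2 : Fin 3) (1:ℤ)) x))) / 2 * a 1 * a 2)|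
      ≤ 2 * Real.pi * (Real.sqrt 2 * (a 0 ^ 2 + a 1 ^ 2 + a 2 ^ 2)) :=
        mul_le_mul_of_nonneg_left hS (by positivity)
    _ = 2 * Real.pi * Real.sqrt 2 * (a 0 ^ 2 + a 1 ^ 2 + a 2 ^ 2) := by ring

/-! ## The capstone: THEOREM 3-L's tail inequality for the ABC linearisation, unit-torus form -/

/-- **Tail inequality of THEOREM 3-L for `U = abc(1,1,1)` (kernel form of INSTAB-BRIDGE §11 l.109,
unit-torus scaling).** For every smooth tail field `w` on `𝕋³ = (ℝ/ℤ)³` with `fourierTruncate N w = 0`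
and all `ν ≥ 0`, `ω`:
`(ν/4π²)∫⟪ΔΔw, Δw⟫ − (1/2π)∫⟪(U·∇)w + (w·∇)U, ΔΔw⟫ − ω∫‖Δw‖²
  ≤ (−ν(N²+1) − ω + (2√3 + √2) + (√6 + 2√3)/√(N²+1) + √3/(N²+1)) · ∫‖Δw‖²`.
Proof: `SharpH2TailDissipativity.sharp_tail_form_le` with `(s, F, L₂, P, Q) =
(2π√2, 2π√3, 4π²√6, 4π²√3, 8π³√3)` (this file) at viscosity `ν/2π` and shift `2πω`, divided by `2π`. -/
theorem abc_tail_form_le {w : UnitAddTorus (Fin 3) → EuclideanSpace ℝ (Fin 3)} (hw : IsSmooth w)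
    {N : ℕ} (h0 : fourierTruncate N w = fun _ => 0) {ν ω : ℝ} (hν : 0 ≤ ν) :
    ν / (4 * Real.pi ^ 2) * (∫ x, ⟪laplacian (laplacian w) x, laplacian w x⟫)
      - 1 / (2 * Real.pi) * (∫ x, ⟪convect (Torus.abcFlow 1 1 1) w x + convect w (Torus.abcFlow 1 1 1) x,
          laplacian (laplacian w) x⟫)
      - ω * (∫ x, ‖laplacian w x‖ ^ 2)
      ≤ (-(ν * ((N : ℝ) ^ 2 + 1)) - ω + (2 * Real.sqrt 3 + Real.sqrt 2)
          + (Real.sqrt 6 + 2 * Real.sqrt 3) / Real.sqrt ((N : ℝ) ^ 2 + 1)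
          + Real.sqrt 3 / ((N : ℝ) ^ 2 + 1)) * (∫ x, ‖laplacian w x‖ ^ 2) := by
  set U := Torus.abcFlow (1:ℝ) 1 1 with hU
  have hπ : 0 < Real.pi := Real.pi_pos
  have h2π : 0 < 2 * Real.pi := by positivity
  -- the five constants
  have hF : ∀ x : UnitAddTorus (Fin 3), ∑ j, ‖partialDeriv j U x‖ ^ 2 ≤ (2 * Real.pi * Real.sqrt 3) ^ 2 := by
    intro x
    rw [hU, sum_norm_sq_partialDeriv_abcFlow, mul_pow, Real.sq_sqrt (by norm_num : (0:ℝ) ≤ 3)]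
    nlinarith [sq_nonneg Real.pi]
  have hL₂ : ∀ x : UnitAddTorus (Fin 3), ‖laplacian U x‖ ≤ 4 * Real.pi ^ 2 * Real.sqrt 6 := by
    intro x
    have h := norm_laplacian_abcFlow_le 1 1 1 x
    norm_num at h
    rw [hU]; exact h
  have hP : ∀ x : UnitAddTorus (Fin 3),
      ∑ m, ∑ j, ‖partialDeriv j (partialDeriv m U) x‖ ^ 2 ≤ (4 * Real.pi ^ 2 * Real.sqrt 3) ^ 2 := by
    intro x
    rw [hU, sum_sum_norm_sq_partialDeriv_partialDeriv_abcFlow, mul_pow,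
      Real.sq_sqrt (by norm_num : (0:ℝ) ≤ 3)]
    nlinarith [sq_nonneg (Real.pi ^ 2)]
  have hQ : ∀ x : UnitAddTorus (Fin 3),
      ∑ j, ‖partialDeriv j (laplacian U) x‖ ^ 2 ≤ (8 * Real.pi ^ 3 * Real.sqrt 3) ^ 2 := by
    intro x
    rw [hU, sum_norm_sq_partialDeriv_laplacian_abcFlow, mul_pow,
      Real.sq_sqrt (by norm_num : (0:ℝ) ≤ 3)]
    nlinarith [sq_nonneg (Real.pi ^ 3)]
  have hS : ∀ (x : UnitAddTorus (Fin 3)) (a : EuclideanSpace ℝ (Fin 3)),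
      |⟪∑ j, a j • partialDeriv j U x, a⟫| ≤ 2 * Real.pi * Real.sqrt 2 * ‖a‖ ^ 2 :=
    fun x a => abs_inner_strain_abcFlow_le x a
  -- the Frobenius tail theorem at viscosity ν/(2π) and shift 2πω
  have hmain := SharpH2TailDissipativity.sharp_tail_form_le (Torus.isSmooth_abcFlow 1 1 1)
    (Torus.isDivFree_abcFlow 1 1 1) hw h0 (ν := ν / (2 * Real.pi)) (ω := 2 * Real.pi * ω)
    (div_nonneg hν h2π.le) (by positivity) (by positivity) (by positivity) hS hF hL₂ hP hQ
  -- rescale by 1/(2π)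
  set Y : ℝ := ∫ x, ‖laplacian w x‖ ^ 2 with hY
  set I1 : ℝ := ∫ x, ⟪laplacian (laplacian w) x, laplacian w x⟫ with hI1
  set I2 : ℝ := ∫ x, ⟪convect U w x + convect w U x, laplacian (laplacian w) x⟫ with hI2
  have hΛ : Real.sqrt (4 * Real.pi ^ 2 * ((N : ℝ) ^ 2 + 1)) = 2 * Real.pi * Real.sqrt ((N : ℝ) ^ 2 + 1) := by
    rw [Real.sqrt_mul (by positivity), show (4 * Real.pi ^ 2 : ℝ) = (2 * Real.pi) ^ 2 by ring,
      Real.sqrt_sq h2π.le]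
  rw [hΛ] at hmain
  have hsq : 0 < Real.sqrt ((N : ℝ) ^ 2 + 1) := Real.sqrt_pos.mpr (by positivity)
  have hN1 : 0 < (N : ℝ) ^ 2 + 1 := by positivity
  have key : ν / (4 * Real.pi ^ 2) * I1 - 1 / (2 * Real.pi) * I2 - ω * Y
      = (1 / (2 * Real.pi)) * (ν / (2 * Real.pi) * I1 - I2 - 2 * Real.pi * ω * Y) := by
    field_simp
    ring
  have key2 : (1 / (2 * Real.pi)) * ((-(ν / (2 * Real.pi) * (4 * Real.pi ^ 2 * ((N : ℝ) ^ 2 + 1)))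
        - 2 * Real.pi * ω
        + (2 * (2 * Real.pi * Real.sqrt 3) + 2 * Real.pi * Real.sqrt 2)
        + (4 * Real.pi ^ 2 * Real.sqrt 6 + 2 * (4 * Real.pi ^ 2 * Real.sqrt 3))
            / (2 * Real.pi * Real.sqrt ((N : ℝ) ^ 2 + 1))
        + 8 * Real.pi ^ 3 * Real.sqrt 3 / (4 * Real.pi ^ 2 * ((N : ℝ) ^ 2 + 1))) * Y)
      = (-(ν * ((N : ℝ) ^ 2 + 1)) - ω + (2 * Real.sqrt 3 + Real.sqrt 2)
          + (Real.sqrt 6 + 2 * Real.sqrt 3) / Real.sqrt ((N : ℝ) ^ 2 + 1)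
          + Real.sqrt 3 / ((N : ℝ) ^ 2 + 1)) * Y := by
    field_simp
    ring
  rw [key, ← key2]
  exact mul_le_mul_of_nonneg_left hmain (by positivity)

end Summit.NavierStokesRegularity.FluidComputer.AbcFlowFrobeniusConstants
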